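import Summits.Ventures.CertifiedManyBodySolver.Rows.TorusCeilingTilt16bCosets
import Literature.MathematicalPhysics.QuantumLattice.TorusPlaquetteProductStates
import Literature.MathematicalPhysics.QuantumLattice.SourcedHubbardBlockCut
import Literature.MathematicalPhysics.QuantumLattice.InterClusterKernelIdentification
import Literature.MathematicalPhysics.QuantumLattice.HubbardSzSectorLadder
import Literature.MathematicalPhysics.QuantumLattice.SectorGroundProjContinuity
import Literature.MathematicalPhysics.QuantumLattice.FinDimSpectrumSectorGibbsLimit
import HarnessLib

/-!
# Torus ceiling — Part V-d(ii): the tilted torus `Λ₁₆″ = ⟨(4,0),(2,4)⟩` on SIXTEEN sites —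
# fermionic product state over the four cosets and kernel admissibility

HONEST FRAMING: first certified bounds; not a superconductivity verdict; every number certified or
labelled float.

Sequel of `TorusCeilingTilt16bCosets` (cosets `cosetSite r`, carrier graph `tilt16bGraph`, block
decomposition `homHubbard_tiltHom16b_eq_sum_jwEmbed`). Here:

* §3 the product-state inequality `minEnergyOn₆₄ (szSector (8 nh) 0) ≤ 4 · minEnergyOn₁₆ (szSector (2 nh) 0)`:
  the Koszul-signed product (`ClusterProduct.Partition.prodFamily`) of four copies of a unit sector
  ground state `ψ` of the 16-site model (`exists_unit_eigen_minEnergyOn`) is a unit vector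
  (`star_prodFamily_dotProduct_self`), lies in the `(4nh, 4nh)` sector (support bookkeeping with
  `IsInSector` and `card_eq_sum_card_part` for the site partition), and is an eigenvector of the
  decomposed Hamiltonian with eigenvalue `4 E₁₆` (`sum_jwEmbed_mulVec_prodFamily_of_eigenvector`, the
  Hubbard Hamiltonian being parity preserving); the variational principle
  (`minEnergyOn_le_rayleigh_of_mem`) finishes;
* §4 the KERNEL admissibility theorem for the 16-site tilted torus:
  `tilt16bTorus_minEnergyOn_div_ge_of_window_certificate` — every window certificate of spreads
  `≤ 3, ≤ 3` certifying `c − Σ‖a_k‖ + (Σ_σ μ_σ)(nh/16 − ν)` bounds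
  `minEnergyOn (hamiltonian tilt16bGraph t U) (szSector (2 nh) 0) / 16` from below (`nh ≤ 16`).

With this file the `(4,4)`-class cap row `Λ₁₆″, PP, (7,7)` of the programme's CEILING-PAGE is
kernel-admissible (K5″): a certified upper bound on the `(7,7)` = `szSector 14 0` ground energy of
`hamiltonian tilt16bGraph t U` (16 sites, 32 bonds; exact rational Rayleigh quotient) caps every such
window certificate. References: Bratteli–Robinson II §5.2.2 (CAR algebra of a direct sum)
[BratteliRobinsonII1997]; Bultinck–Williamson–Haegeman–Verstraete, PRB 95 (2017) 075108 §IV.A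
(fermionic reordering signs) [BultinckWilliamsonHaegemanVerstraete2017fMPS]; Tasaki (2020) §2.2
(variational principle) [Tasaki2020]; Han (2020) §3 / Kull–Schuch–Dive–Navascués (2024) (window
certificates) [Han2020Bootstrap]. Tree: `TorusCeilingTilt16bCosets`, `TorusCeilingLatHom` (Part V-c),
`ClusterProductStates`, `TorusPlaquetteProductStates` (the pattern followed here).
-/

noncomputable section

open Matrix Finset
open Literature.MathematicalPhysics.QuantumLattice
open Literature.MathematicalPhysics.QuantumFieldTheory hiding Site
open Literature.MathematicalPhysics.QuantumManyBody.StateRelaxation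
open Literature.Probability.LatticeModels
open HubbardWave0 JWEmbed TwoCluster
open scoped ComplexOrder ComplexConjugate

namespace Summit.Ventures.CertifiedManyBodySolver.Rows

section Tilt16bProduct

/-! ### §3. The product state over the four cosets and the energy inequality -/

/-- Up-spin parts commute with taking the coset part. [folklore] -/
theorem upPart_part (r : Fin 4) (s : Finset (Orb (FermionTorus 2 8))) :
    upPart (tilt16bPartition.part r s) = tilt16bSitePartition.part r (upPart s) := by
  ext a
  simp only [upPart, Finset.mem_filter, Finset.mem_univ, true_and, ClusterProduct.Partition.mem_part]
  rfl

/-- Down-spin parts commute with taking the coset part. [folklore] -/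
theorem downPart_part (r : Fin 4) (s : Finset (Orb (FermionTorus 2 8))) :
    downPart (tilt16bPartition.part r s) = tilt16bSitePartition.part r (downPart s) := by
  ext a
  simp only [downPart, Finset.mem_filter, Finset.mem_univ, true_and, ClusterProduct.Partition.mem_part]
  rfl

/-- **Sectors add under the product**: if every factor lies in the `(a, b)` sector of the 16-site Fock
space, the product state lies in the `(4a, 4b)` sector of the 64-site Fock space. [folklore] -/
theorem isInSector_prodFamily {a b : ℕ} {ψ : Fin 4 → Fock (Orb (FermionTorus 1 16))}
    (hψ : ∀ r, IsInSector a b (ψ r)) : IsInSector (4 * a) (4 * b) (tilt16bPartition.prodFamily ψ) := by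
  intro s hs
  rw [ClusterProduct.Partition.prodFamily_apply]
  by_cases hall : ∀ r, (upPart (tilt16bPartition.part r s)).card = a ∧ (downPart (tilt16bPartition.part r s)).card = b
  · exfalso
    apply hs
    constructor
    · rw [tilt16bSitePartition.card_eq_sum_card_part (upPart s)]
      calc ∑ r, (tilt16bSitePartition.part r (upPart s)).card = ∑ r : Fin 4, a :=
            Finset.sum_congr rfl fun r _ => by rw [← upPart_part, (hall r).1]
        _ = 4 * a := by simp
    · rw [tilt16bSitePartition.card_eq_sum_card_part (downPart s)]
      calc ∑ r, (tilt16bSitePartition.part r (downPart s)).card = ∑ r : Fin 4, b :=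
            Finset.sum_congr rfl fun r _ => by rw [← downPart_part, (hall r).2]
        _ = 4 * b := by simp
  · obtain ⟨r, hr⟩ := not_forall.1 hall
    rw [Finset.prod_eq_zero (Finset.mem_univ r) (hψ r _ hr), mul_zero]

/-- The joint sector `(N, S^z) = (2 nh, 0)` is the `(nh, nh)` sector. [folklore] -/
theorem szSector_two_mul_eq {Λ : Type*} [LinearOrder Λ] [Fintype Λ] (nh : ℕ) :
    (szSector (2 * nh) 0 : Submodule ℂ (Fock (Orb Λ))) = szSector (nh + nh) (((nh : ℝ) - nh) / 2) := by
  rw [two_mul, sub_self, zero_div]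

/-- **The product-state inequality** (the paper step of Part V-c, now in the kernel): the `S^z = 0`,
`8 nh`-particle ground energy of the 64-site four-copy model is at most four times the `S^z = 0`,
`2 nh`-particle ground energy of ONE 16-site copy (`nh ≤ 16`): the product of four copies of a sector
ground state of `hamiltonian tilt16bGraph t U` is a trial state. [cite: Tasaki2020, §2.2] -/
theorem minEnergyOn_homHubbard_tiltHom16b_le (t U : ℝ) {nh : ℕ} (hn : nh ≤ Fintype.card (FermionTorus 1 16)) :
    (homHubbard tiltHom16b t U).minEnergyOn (szSector (2 * (4 * nh)) 0) ≤
      4 * (hamiltonian tilt16bGraph t U).minEnergyOn (szSector (2 * nh) 0) := by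
  classical
  set H₁ := hamiltonian tilt16bGraph t U with hH₁
  set E₁ : ℝ := H₁.minEnergyOn (szSector (2 * nh) 0) with hE₁
  have hHc := hamiltonian_isHermitian_and_commute_holds tilt16bGraph t U
  have hH₁h : H₁.IsHermitian := hHc.1
  have hK : (szSector (2 * nh) 0 : Submodule ℂ (Fock (Orb (FermionTorus 1 16)))) ≠ ⊥ := szSector_ne_bot t U hn
  obtain ⟨ψ, hψK, hψ1, hHψ⟩ := exists_unit_eigen_minEnergyOn hH₁h (szSector (2 * nh) 0)
    (fun v hv => mulVec_mem_szSector_of_commute hHc.2.1 hHc.2.2 hv) hK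
  have hψin : IsInSector nh nh ψ := by
    rw [szSector_two_mul_eq] at hψK
    exact (mem_szSector_iff_isInSector nh nh ψ).1 hψK
  set Ψ : Fock (Orb (FermionTorus 2 8)) := tilt16bPartition.prodFamily (fun _ : Fin 4 => ψ) with hΨ
  have hΨin : IsInSector (4 * nh) (4 * nh) Ψ := isInSector_prodFamily fun _ => hψin
  have hΨK : Ψ ∈ (szSector (2 * (4 * nh)) 0 : Submodule ℂ (Fock (Orb (FermionTorus 2 8)))) := by
    rw [szSector_two_mul_eq]
    exact (mem_szSector_iff_isInSector (4 * nh) (4 * nh) Ψ).2 hΨin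
  have hΨ1 : star Ψ ⬝ᵥ Ψ = 1 := tilt16bPartition.star_prodFamily_dotProduct_self _ fun _ => hψ1
  have hHΨ : homHubbard tiltHom16b t U *ᵥ Ψ = (∑ _r : Fin 4, ((E₁ : ℝ) : ℂ)) • Ψ := by
    rw [homHubbard_tiltHom16b_eq_sum_jwEmbed]
    exact tilt16bPartition.sum_jwEmbed_mulVec_prodFamily_of_eigenvector
      (fun _ => isParityPreserving_hamiltonian tilt16bGraph t U) (fun _ => hHψ)
  have hsum : (∑ _r : Fin 4, ((E₁ : ℝ) : ℂ)) = (((4 * E₁ : ℝ)) : ℂ) := by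
    rw [Finset.sum_const, Finset.card_univ, Fintype.card_fin]
    push_cast
    ring
  have hray : (star Ψ ⬝ᵥ homHubbard tiltHom16b t U *ᵥ Ψ).re = 4 * E₁ := by
    rw [hHΨ, hsum, dotProduct_smul, hΨ1, smul_eq_mul, mul_one, Complex.ofReal_re]
  calc (homHubbard tiltHom16b t U).minEnergyOn (szSector (2 * (4 * nh)) 0)
      ≤ (star Ψ ⬝ᵥ homHubbard tiltHom16b t U *ᵥ Ψ).re :=
        minEnergyOn_le_rayleigh_of_mem (homHubbard_isHermitian tiltHom16b t U) _ hΨK hΨ1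
    _ = 4 * E₁ := hray

/-! ### §4. The 16-site tilted torus `Λ₁₆″` caps spread-`(3,3)` window certificates -/

/-- **The 16-site tilted torus `Λ₁₆″ = ⟨(4,0),(2,4)⟩` caps spread-`(3,3)` window certificates (kernel
admissibility of the CEILING-PAGE row `Λ₁₆″`).** For every square-lattice NN-Hubbard window certificate
(exactly the data of `groundEnergyAt_div_ge_of_window_certificate`) whose outer window `Λ'` has
coordinate spreads `≤ 3, ≤ 3`, certifying `c − Σ‖a_k‖ + (Σ_σ μ_σ)(nh/16 − ν)`, that number is at most
the `S^z = 0`, `2·nh`-particle ground energy PER SITE of the 16-site model `hamiltonian tilt16bGraph t U`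
(`nh ≤ 16`; the `(7,7)` sector is `nh = 7`): Part V-c's 64-site bound followed by the product-state
inequality `minEnergyOn₆₄ (8 nh) ≤ 4 · minEnergyOn₁₆ (2 nh)`. Consequently a certified upper bound on that
16-site sector energy caps every such certificate. [cite: Han2020Bootstrap, §3] -/
theorem tilt16bTorus_minEnergyOn_div_ge_of_window_certificate (t U : ℝ) {nh : ℕ}
    (hn : nh ≤ Fintype.card (FermionTorus 1 16))
    {Λ Λ' : Finset (Site 2)} (hΛ : Λ ⊆ Λ')
    (hspread : ∀ x ∈ Λ', ∀ y ∈ Λ', |x 0 - y 0| ≤ (3 : ℤ) ∧ |x 1 - y 1| ≤ (3 : ℤ))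
    (hclosed : ∀ x ∈ Λ, ∀ i : Fin 2, x + unitVec i ∈ Λ' ∧ x - unitVec i ∈ Λ')
    (h0 : thicken ({0} : Finset (Site 2)) 1 ⊆ Λ') (hz : (0 : Site 2) ∈ Λ')
    (μ : Fin 2 → ℝ) (ν : ℝ)
    {m : Type*} [Fintype m] [DecidableEq m] {Λm : Matrix m m ℂ} (hΛm : Λm.PosSemidef)
    (O : m → FermionOp Λ')
    {κ : Type*} (s : Finset κ) (B : κ → FermionOp Λ)
    {ι : Type*} (tt : Finset ι) (v : ι → Site 2) (hsh : ∀ l, shiftSet (v l) Λ ⊆ Λ') (Y : ι → FermionOp Λ)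
    {γ : Type*} (u : Finset γ) (b : γ → ℂ) (cw : γ → List (Orb (PolySite Λ') × Bool))
    (hcw : ∀ j ∈ u, ladderCharge (cw j) ≠ 0 ∨ ladderSpinCharge (cw j) ≠ 0)
    {δ : Type*} (ah : Finset δ) (dc : δ → ℝ) (V : δ → FermionOp Λ')
    {κ'' : Type*} (w : Finset κ'') (a : κ'' → ℂ) (word : κ'' → List (Orb (PolySite Λ') × Bool)) {c : ℝ}
    (hcert : fermionEmbed (PolySite.incl h0) ((hubbardFermionInteraction 2 t U).meanEnergyObs 1) -
        (c : ℂ) • (1 : FermionOp Λ') -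
        ∑ σ : Fin 2, ((μ σ : ℝ) : ℂ) • (nAt 0 hz σ - ((ν : ℝ) : ℂ) • (1 : FermionOp Λ')) =
      gramForm Λm O +
        (∑ k ∈ s, ((hubbardFermionInteraction 2 t U).localHamiltonian Λ' * fermionEmbed (PolySite.incl hΛ) (B k) -
            fermionEmbed (PolySite.incl hΛ) (B k) * (hubbardFermionInteraction 2 t U).localHamiltonian Λ') +
          ∑ l ∈ tt, (fermionEmbed (PolySite.incl (hsh l)) (fermionEmbed (PolySite.shiftEmb (v l) Λ) (Y l)) -
            fermionEmbed (PolySite.incl hΛ) (Y l)) +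
          ∑ j ∈ u, b j • ladderWord (cw j)) +
        (∑ m' ∈ ah, ((dc m' : ℝ) : ℂ) • ((V m')ᴴ - V m') + ∑ k ∈ w, a k • ladderWord (word k))) :
    c - ∑ k ∈ w, ‖a k‖ + (∑ σ : Fin 2, μ σ) * ((nh : ℝ) / 16 - ν) ≤
      (hamiltonian tilt16bGraph t U).minEnergyOn (szSector (2 * nh) 0) / 16 := by
  have h16 : Fintype.card (FermionTorus 1 16) = 16 := by simp [FermionTorus, Fintype.card_lex]
  have h64c : Fintype.card (FermionTorus 2 8) = 64 := by simp [FermionTorus, Fintype.card_lex]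
  have hn4 : 4 * nh ≤ Fintype.card (FermionTorus 2 8) := by
    rw [h64c]
    rw [h16] at hn
    omega
  have h64 := tilt16b_minEnergyOn_div_ge_of_window_certificate t U hn4 hΛ hspread hclosed h0 hz μ ν
    hΛm O s B tt v hsh Y u b cw hcw ah dc V w a word hcert
  have hprod := minEnergyOn_homHubbard_tiltHom16b_le t U hn
  have hq : (((4 * nh : ℕ) : ℝ) / 64) = (nh : ℝ) / 16 := by
    push_cast
    ring
  rw [hq] at h64
  calc c - ∑ k ∈ w, ‖a k‖ + (∑ σ : Fin 2, μ σ) * ((nh : ℝ) / 16 - ν)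
      ≤ (homHubbard tiltHom16b t U).minEnergyOn (szSector (2 * (4 * nh)) 0) / 64 := h64
    _ ≤ 4 * (hamiltonian tilt16bGraph t U).minEnergyOn (szSector (2 * nh) 0) / 64 :=
        div_le_div_of_nonneg_right hprod (by norm_num)
    _ = (hamiltonian tilt16bGraph t U).minEnergyOn (szSector (2 * nh) 0) / 16 := by ring

end Tilt16bProduct

end Summit.Ventures.CertifiedManyBodySolver.Rows

end
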